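import Literature.NumberTheory.Transcendental.KZProductIdeal
import Literature.NumberTheory.Transcendental.LindemannWeierstrassProofs
import Literature.NumberTheory.Transcendental.AyoubPeriodSeries

/-!
# Sketch — crux-ideate round 1, ideator 1, crux `AyoubPiLocalKernel` (stmt-KontsevichZagierPeriods-0541)

First lemmas of the two crux idea cards `lefschetz-spectrum-split` and `ayoub-compact-presentation`,
stated over existing declarations. Card 1's first lemma is PROVED here (0 sorries, axioms
propext / Classical.choice / Quot.sound): `piLocalKernel_iff` (the crux, in its closed form
`KZ.PiLocalKernel` ↔ the route decl by `ayoubPiLocalKernel_iff_piLocalKernel`, p135819, splits EXACTLY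
as GenericPiKernel ∧ NoPiEigenvalues) and `noPiEigenvalues_of_krullSeparation`. Card 2's pieces only
elaborate (the composition is the crux-plan stage's job).
-/

set_option linter.dupNamespace false

open Literature.NumberTheory.Transcendental

namespace Summit.KontsevichZagierPeriods.KontsevichZagierPeriods.Cruxes.AyoubPiLocalKernel

/-! ## Card `lefschetz-spectrum-split` -/

noncomputable abbrev T : KZ.FormalRep → KZ.FormalRep := fun x => KZ.of KZ.piRep * x

noncomputable def polyT (d : ℕ) (a : ℕ → ℤ) (c : KZ.FormalRep) : KZ.FormalRep :=
  ∑ k ∈ Finset.range (d + 1), a k • (T^[k] c)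

def GenericPiKernel : Prop :=
  ∀ c : KZ.FormalRep, KZ.eval c = 0 →
    ∃ (d : ℕ) (a : ℕ → ℤ), (∃ k ≤ d, a k ≠ 0) ∧ polyT d a c ∈ KZ.relations

def NoPiEigenvalues : Prop :=
  ∀ (c : KZ.FormalRep) (d : ℕ) (a : ℕ → ℤ), a 0 ≠ 0 → polyT d a c ∈ KZ.relations →
    ∃ N : ℕ, T^[N] c ∈ KZ.relations

/-- `eval (T^k c) = π^k · eval c`. -/
theorem eval_T_iterate (k : ℕ) (c : KZ.FormalRep) :
    KZ.eval (T^[k] c) = Real.pi ^ k * KZ.eval c := by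
  induction k with
  | zero => simp
  | succ k ih =>
    rw [Function.iterate_succ_apply', KZ.eval_piRep_mul, ih, pow_succ]
    ring

/-- `eval (Q(T) c) = Q(π) · eval c`. -/
theorem eval_polyT (d : ℕ) (a : ℕ → ℤ) (c : KZ.FormalRep) :
    KZ.eval (polyT d a c) = (∑ k ∈ Finset.range (d + 1), (a k : ℝ) * Real.pi ^ k) * KZ.eval c := by
  unfold polyT
  rw [map_sum, Finset.sum_mul]
  refine Finset.sum_congr rfl fun k _ => ?_
  rw [map_zsmul, eval_T_iterate, zsmul_eq_mul]
  ring

/-- Lindemann: a non-trivial integer combination of powers of `π` is non-zero. -/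
theorem sum_mul_pi_pow_ne_zero (d : ℕ) (a : ℕ → ℤ) (h : ∃ k ≤ d, a k ≠ 0) :
    (∑ k ∈ Finset.range (d + 1), (a k : ℝ) * Real.pi ^ k) ≠ 0 := by
  intro hsum
  obtain ⟨k, hk, hak⟩ := h
  apply transcendental_pi_holds
  refine ⟨∑ j ∈ Finset.range (d + 1), Polynomial.monomial j (a j : ℚ), ?_, ?_⟩
  · intro hp
    have := congrArg (fun p => Polynomial.coeff p k) hp
    simp only [Polynomial.finsetSum_coeff, Polynomial.coeff_monomial, Polynomial.coeff_zero,
      Finset.sum_ite_eq', Finset.mem_range] at this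
    rw [if_pos (by omega)] at this
    exact hak (by exact_mod_cast this)
  · rw [map_sum]
    simp only [Polynomial.aeval_monomial, eq_ratCast, Rat.cast_intCast]
    exact hsum

theorem forward (hsound : KZ.relations_le_ker_eval) (h : KZ.PiLocalKernel) :
    GenericPiKernel ∧ NoPiEigenvalues := by
  constructor
  · intro c hc
    obtain ⟨N, hN⟩ := h c hc
    refine ⟨N, fun k => if k = N then 1 else 0, ⟨N, le_rfl, by simp⟩, ?_⟩
    have : polyT N (fun k => if k = N then 1 else 0) c = T^[N] c := by
      unfold polyT
      rw [Finset.sum_eq_single N]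
      · simp
      · intro b _ hb; simp [hb]
      · intro h; exact absurd (Finset.self_mem_range_succ N) h
    rw [this]; exact hN
  · intro c d a ha0 hrel
    have hker := hsound hrel
    rw [AddMonoidHom.mem_ker, eval_polyT] at hker
    have hS := sum_mul_pi_pow_ne_zero d a ⟨0, Nat.zero_le _, ha0⟩
    have hc : KZ.eval c = 0 := (mul_eq_zero.mp hker).resolve_left hS
    exact h c hc

/-- Shift identity: if `a j = 0` for `j < v ≤ d`, then `Q(T) c = Q'(T) (T^v c)` with `Q' = Q / T^v`. -/
theorem polyT_shift (d v : ℕ) (hv : v ≤ d) (a : ℕ → ℤ) (hz : ∀ j < v, a j = 0)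
    (c : KZ.FormalRep) :
    polyT d a c = polyT (d - v) (fun j => a (v + j)) (T^[v] c) := by
  unfold polyT
  have hd : d + 1 = v + (d - v + 1) := by omega
  rw [hd, Finset.sum_range_add]
  have h0 : ∑ x ∈ Finset.range v, a x • T^[x] c = 0 :=
    Finset.sum_eq_zero fun x hx => by rw [hz x (Finset.mem_range.mp hx), zero_smul]
  rw [h0, zero_add]
  refine Finset.sum_congr rfl fun x _ => ?_
  rw [← Function.iterate_add_apply, Nat.add_comm x v]

theorem backward (hA : GenericPiKernel) (hR : NoPiEigenvalues) : KZ.PiLocalKernel := by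
  intro c hc
  obtain ⟨d, a, hex, hrel⟩ := hA c hc
  classical
  have hex' : ∃ j, a j ≠ 0 := by obtain ⟨k, _, hk⟩ := hex; exact ⟨k, hk⟩
  set v := Nat.find hex' with hv_def
  have hv : a v ≠ 0 := Nat.find_spec hex'
  have hmin : ∀ j < v, a j = 0 := fun j hj => by
    by_contra h
    exact absurd (Nat.find_min' hex' h) (by omega)
  have hvd : v ≤ d := by
    obtain ⟨k, hkd, hk⟩ := hex
    exact (Nat.find_min' hex' hk).trans hkd
  rw [polyT_shift d v hvd a hmin c] at hrel
  obtain ⟨N, hN⟩ := hR (T^[v] c) (d - v) (fun j => a (v + j)) (by simpa using hv) hrel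
  refine ⟨N + v, ?_⟩
  rw [Function.iterate_add_apply]
  exact hN

theorem piLocalKernel_iff : KZ.PiLocalKernel ↔ GenericPiKernel ∧ NoPiEigenvalues :=
  ⟨forward KZ.relations_le_ker_eval_holds, fun h => backward h.1 h.2⟩


/-! ### Krull separation ⇒ no π-eigenvalues -/

def KrullSeparation : Prop :=
  ∀ c : KZ.FormalRep,
    (∀ N : ℕ, ∃ (y : KZ.FormalRep) (m : ℤ), m ≠ 0 ∧ m • c - T^[N] y ∈ KZ.relations) →
    ∃ N : ℕ, T^[N] c ∈ KZ.relations

theorem T_add (x y : KZ.FormalRep) : T (x + y) = T x + T y := mul_add _ _ _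
theorem T_zsmul (m : ℤ) (x : KZ.FormalRep) : T (m • x) = m • T x := mul_smul_comm _ _ _
theorem T_neg (x : KZ.FormalRep) : T (-x) = -T x := mul_neg _ _
theorem T_sub (x y : KZ.FormalRep) : T (x - y) = T x - T y := mul_sub _ _ _

theorem T_iter_add (k : ℕ) (x y : KZ.FormalRep) : T^[k] (x + y) = T^[k] x + T^[k] y := by
  induction k with
  | zero => rfl
  | succ k ih => rw [Function.iterate_succ_apply', ih, T_add, ← Function.iterate_succ_apply' (f := T),
      ← Function.iterate_succ_apply' (f := T)]

theorem T_iter_zsmul (k : ℕ) (m : ℤ) (x : KZ.FormalRep) : T^[k] (m • x) = m • T^[k] x := by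
  induction k with
  | zero => rfl
  | succ k ih => rw [Function.iterate_succ_apply', ih, T_zsmul, ← Function.iterate_succ_apply' (f := T)]

theorem T_iter_neg (k : ℕ) (x : KZ.FormalRep) : T^[k] (-x) = -T^[k] x := by
  induction k with
  | zero => rfl
  | succ k ih => rw [Function.iterate_succ_apply', ih, T_neg, ← Function.iterate_succ_apply' (f := T)]

theorem T_iter_sub (k : ℕ) (x y : KZ.FormalRep) : T^[k] (x - y) = T^[k] x - T^[k] y := by
  rw [sub_eq_add_neg, T_iter_add, T_iter_neg, ← sub_eq_add_neg]

theorem T_iter_mem (k : ℕ) {x : KZ.FormalRep} (hx : x ∈ KZ.relations) : T^[k] x ∈ KZ.relations :=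
  KZ.piRep_mul_iterate_mem_relations k hx

/-- `W x = Σ_{k<d} a_{k+1} • T^k x`, so that `Q(T) x = a₀ • x + T (W x)`. -/
noncomputable def W (d : ℕ) (a : ℕ → ℤ) (x : KZ.FormalRep) : KZ.FormalRep :=
  ∑ k ∈ Finset.range d, a (k + 1) • (T^[k] x)

theorem polyT_eq_W (d : ℕ) (a : ℕ → ℤ) (c : KZ.FormalRep) :
    polyT d a c = a 0 • c + T (W d a c) := by
  unfold polyT W
  rw [Finset.sum_range_succ', add_comm]
  congr 1
  rw [show T (∑ k ∈ Finset.range d, a (k + 1) • T^[k] c)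
      = ∑ k ∈ Finset.range d, T (a (k + 1) • T^[k] c) from map_sum (KZ.FormalRep.mul (KZ.of KZ.piRep)) _ _]
  refine Finset.sum_congr rfl fun k _ => ?_
  rw [T_zsmul, ← Function.iterate_succ_apply' (f := T)]

theorem W_add (d : ℕ) (a : ℕ → ℤ) (x y : KZ.FormalRep) : W d a (x + y) = W d a x + W d a y := by
  unfold W
  rw [← Finset.sum_add_distrib]
  refine Finset.sum_congr rfl fun k _ => ?_
  rw [T_iter_add, smul_add]

theorem W_zsmul (d : ℕ) (a : ℕ → ℤ) (m : ℤ) (x : KZ.FormalRep) : W d a (m • x) = m • W d a x := by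
  unfold W
  rw [Finset.smul_sum]
  refine Finset.sum_congr rfl fun k _ => ?_
  rw [T_iter_zsmul, smul_comm]

theorem W_neg (d : ℕ) (a : ℕ → ℤ) (x : KZ.FormalRep) : W d a (-x) = -W d a x := by
  rw [← neg_one_zsmul, W_zsmul, neg_one_zsmul]

theorem W_sub (d : ℕ) (a : ℕ → ℤ) (x y : KZ.FormalRep) : W d a (x - y) = W d a x - W d a y := by
  rw [sub_eq_add_neg, W_add, W_neg, ← sub_eq_add_neg]

theorem W_mem (d : ℕ) (a : ℕ → ℤ) {x : KZ.FormalRep} (hx : x ∈ KZ.relations) :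
    W d a x ∈ KZ.relations := by
  unfold W
  exact Finset.sum_induction _ (· ∈ KZ.relations) (fun _ _ => add_mem) (zero_mem _)
    (fun k _ => KZ.relations.zsmul_mem (T_iter_mem k hx) _)

theorem W_T_iter (d : ℕ) (a : ℕ → ℤ) (N : ℕ) (y : KZ.FormalRep) :
    W d a (T^[N] y) = T^[N] (W d a y) := by
  unfold W
  rw [show T^[N] (∑ k ∈ Finset.range d, a (k + 1) • T^[k] y)
      = ∑ k ∈ Finset.range d, T^[N] (a (k + 1) • T^[k] y) from ?_]
  · refine Finset.sum_congr rfl fun k _ => ?_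
    rw [T_iter_zsmul, ← Function.iterate_add_apply, ← Function.iterate_add_apply, Nat.add_comm k N]
  · induction (Finset.range d) using Finset.induction_on with
    | empty =>
      simp only [Finset.sum_empty]
      clear a d y
      induction N with
      | zero => rfl
      | succ n ih => rw [Function.iterate_succ_apply', ih]; exact mul_zero _
    | insert k s hk ih => rw [Finset.sum_insert hk, Finset.sum_insert hk, T_iter_add, ih]

theorem divisible_of_polyT_mem (d : ℕ) (a : ℕ → ℤ) (c : KZ.FormalRep)
    (hrel : polyT d a c ∈ KZ.relations) :
    ∀ N : ℕ, ∃ y : KZ.FormalRep, (a 0) ^ N • c - T^[N] y ∈ KZ.relations := by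
  intro N
  induction N with
  | zero => exact ⟨c, by simp⟩
  | succ N ih =>
    obtain ⟨y, hy⟩ := ih
    refine ⟨-(W d a y), ?_⟩
    rw [polyT_eq_W] at hrel
    -- ρ₀ := a 0 • c + T (W c) ∈ rel ;  ρ₁ := a0^N • c - T^N y ∈ rel
    have key : (a 0) ^ (N + 1) • c - T^[N + 1] (-(W d a y))
        = (a 0) ^ N • (a 0 • c + T (W d a c)) - T (W d a ((a 0) ^ N • c - T^[N] y)) := by
      rw [W_sub, W_zsmul, W_T_iter, T_sub, T_zsmul, ← Function.iterate_succ_apply' (f := T),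
        T_iter_neg, smul_add, pow_succ, mul_smul]
      abel
    rw [key]
    exact sub_mem (KZ.relations.zsmul_mem hrel _) (KZ.piRep_mul_mem_relations (W_mem d a hy))

theorem noPiEigenvalues_of_krullSeparation (hKS : KrullSeparation) : NoPiEigenvalues := by
  intro c d a ha0 hrel
  refine hKS c fun N => ?_
  obtain ⟨y, hy⟩ := divisible_of_polyT_mem d a c hrel N
  exact ⟨y, (a 0) ^ N, pow_ne_zero _ ha0, hy⟩

/-! ## Card `ayoub-compact-presentation` -/

/-- Real-coefficient elements of Ayoub's `𝒪_{ℚ-alg}(𝔻̄^∞)` (`AyoubPeriodSeries.lean`, `k = ℚ`). -/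
def OanReal : Set AyoubRel.CSeries :=
  {F | F ∈ AyoubRel.Oan (algebraMap ℚ ℂ) ∧ ∀ a, (MvPowerSeries.coeff a F).im = 0}

/-- The value at a real point of the `n`-cube of a series in the first `n` variables. -/
noncomputable def seriesSum (n : ℕ) (F : AyoubRel.CSeries) (x : Fin n → ℝ) : ℂ :=
  ∑' a : ℕ →₀ ℕ, MvPowerSeries.coeff a F *
    ∏ i ∈ a.support, (if h : i < n then ((x ⟨i, h⟩ : ℝ) : ℂ) else 0) ^ (a i)

/-- Ayoub's "well-chosen element" for `π`, placed in the variable `zᵢ`: the Taylor series of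
`6/√(4 − zᵢ²) = 3·(1 − zᵢ²/4)^{-1/2} = Σ_k 3·binom(2k,k)·16^{-k}·zᵢ^{2k}` (radius `2 > 1`, algebraic,
rational coefficients, `∫₀¹ = 6·arcsin(1/2) = π`). -/
noncomputable def uPiVar (i : ℕ) : AyoubRel.CSeries := fun a =>
  if a = Finsupp.single i (a i) ∧ Even (a i)
  then (3 * (Nat.centralBinom (a i / 2) : ℂ) / 16 ^ (a i / 2)) else 0

/-- `N` fresh copies of the `π`-element in the variables `z_m, …, z_{m+N-1}` (disjoint from a series
in the first `m` variables): the literal meaning of localising Ayoub's `𝒫^eff` at the class `[u_π]`. -/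
noncomputable def uPiPow (m N : ℕ) : AyoubRel.CSeries :=
  ∏ j ∈ Finset.range N, uPiVar (m + j)

/-- AYOUB'S CONJECTURE 7 in the compact (polydisc) presentation, Remark-13 form, over `k = ℚ`,
real coefficients, localised at the REAL period `π` through the FIXED element `u_π` (in place of
`2πi`; `(2πi)² = −4π²`): a real algebraic power series in `z₀,…,z_{m-1}` converging beyond the
closed unit polydisc with `∫_{[0,1]^m} F = 0` becomes, after multiplication by `N` fresh copies of
`u_π`, a `ℚ`-combination of Stokes elements `∂G/∂zᵢ − G|_{zᵢ=1} + G|_{zᵢ=0}`, `G` real in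
`𝒪_{ℚ-alg}(𝔻̄^∞)`. OPEN — period-conjecture strength (Ayoub2014 Def. 10, Prop. 11, Conj. 7,
Rem. 13; HuberMullerStachPeriods2017 Def. 13.2.20, Prop. 13.2.21). -/
def AyoubRealCubeKernel : Prop :=
  ∀ (m : ℕ) (F : AyoubRel.CSeries), F ∈ OanReal → AyoubRel.DependsOnlyOnLT F m →
    AyoubRel.intC F = 0 →
    ∃ N : ℕ, uPiPow m N * F ∈
      AyoubRel.kSpan (algebraMap ℚ ℂ) {x | ∃ G ∈ OanReal, ∃ i : ℕ, x = AyoubRel.relAC i G}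

/-- POLYDISC NORMAL FORM (dictionary, surjectivity side): modulo the four moves every formal
combination is ONE cube representation whose integrand is (the sum of) a real element of
`𝒪_{ℚ-alg}(𝔻̄^∞)` — CubeNashNormalForm (route LiftingCriteria) + subdivision/affine rescaling. -/
def PolydiscNormalForm : Prop :=
  ∀ c : KZ.FormalRep, ∃ (n : ℕ) (F : AyoubRel.CSeries) (s : KZ.IntegralRep n),
    F ∈ OanReal ∧ AyoubRel.DependsOnlyOnLT F n ∧
    s.domain = Set.pi Set.univ (fun _ => Set.Icc (0:ℝ) 1) ∧
    (∀ x ∈ s.domain, ((s.integrand x : ℝ) : ℂ) = seriesSum n F x) ∧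
    AyoubRel.intC F = ((s.value : ℝ) : ℂ) ∧
    c - KZ.of s ∈ KZ.relations

/-- STOKES CALIBRATION (dictionary, relation side): the cube representation of a Stokes element
is a relation of the four-move calculus (cf. item AyoubRelACubeCalibration of AyoubSpecialisation). -/
def StokesCalibration : Prop :=
  ∀ (n : ℕ) (i : ℕ), i < n → ∀ G ∈ OanReal, AyoubRel.DependsOnlyOnLT G n →
    ∀ s : KZ.IntegralRep n, s.domain = Set.pi Set.univ (fun _ => Set.Icc (0:ℝ) 1) →
      (∀ x ∈ s.domain, ((s.integrand x : ℝ) : ℂ) = seriesSum n (AyoubRel.relAC i G) x) →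
      KZ.of s ∈ KZ.relations

/-- DISC CALIBRATION: the cube representation of `u_π`, i.e. `6/√(4 − x²)` on `[0,1]`
(`arcsin(1/2) = π/6`), is move-equivalent to the disc `[π]` (sine triplication as the change of
variables `t ↦ 3t − 4t³` from `[0,1/2]` onto `[0,1]`, `z = 2t`, then the disc ↔ `2√(1−x²)` ↔
`1/√(1−t²)` chain of KontsevichZagier2001 §1.1). -/
def DiscCalibration : Prop :=
  ∀ r : KZ.IntegralRep 1, r.domain = Set.pi Set.univ (fun _ => Set.Icc (0:ℝ) 1) →
    (∀ x ∈ r.domain, ((r.integrand x : ℝ) : ℂ) = seriesSum 1 (uPiVar 0) x) →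
    KZ.of r - KZ.of KZ.piRep ∈ KZ.relations

/-- FIRST LEMMA (card `ayoub-compact-presentation`), the composition to be kernel-checked at the
crux-plan stage: three dictionary statements + Ayoub's conjecture give the crux (closed form
`KZ.PiLocalKernel`, ↔ the route decl by `ayoubPiLocalKernel_iff_piLocalKernel`, p135819). -/
theorem piLocalKernel_of_ayoubRealCubeKernel
    (h₁ : PolydiscNormalForm) (h₂ : StokesCalibration) (h₃ : DiscCalibration)
    (h₄ : AyoubRealCubeKernel) : KZ.PiLocalKernel := by
  sorry


end Summit.KontsevichZagierPeriods.KontsevichZagierPeriods.Cruxes.AyoubPiLocalKernel
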